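import Summits.Ventures.HodgeRepro.Night1ProductWeilExceptional

/-!
# The level-3 classes of ROUTE.md §3.6 are exceptional on the kernel: the degree-8 family `B₃` (a repeated
corner) and typer's decic witness (six distinct corners) have no complementary corners, so their Weil
spaces meet the products of three divisor classes only in `0`

Blind re-derivation cell `pub-hodge-repro`, seat `night-1` (gen 5, tenth file).  Imports night-1's
`Night1ProductWeilExceptional` (`weilSpaceProd_inf_divisorPowerIn_eq_bot`: no complementary corners ⇒
`W ⊓ D^k = 0`) and, through the chain, gen 2's `level3Family` / `IsPlaceEnum` and typer's `level3Witness`.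

ROUTE.md §3.6 (ii)–(iii) exhibits the `(eq2)`-multisets that no `p = 2` mechanism reaches: in degree 8 ONE
`B₄`-orbit, represented by `{Φ̄, Φ̄, Φ^{(1)}, Φ^{(2)}, Φ^{(3)}, Φ^{(4)}}` (the conjugate type twice and the four
single flips of `Φ`; gen 2's `level3Family c Φ π`, `SumP 3`), and in degree 10 typer g5's decic witness
(`level3Witness`, six distinct corners).  Their Weil classes live in codimension 3 (`k = 3`, `|ι| = 6`).
This file records that they are exceptional:

* `level3Family_ne_compl` — no two corners of `B₃` are complementary (`|G| > 4`; witnesses: `π i` for the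
  pairs `(Φ̄, Φ^{(i)})`, an embedding of a third place for `(Φ^{(i)}, Φ^{(j)})`);
* **`level3Family_weilSpaceProd_inf_divisorPowerIn_eq_bot`** — `W ⊓ D³ = 0` on the 24-fold `B₃`;
* `level3Witness_ne_compl` (by `decide` on the sealed-style table) and
  **`level3Witness_weilSpaceProd_inf_divisorPowerIn_eq_bot`** — `W ⊓ D³ = 0` on the decic 30-fold.

So the level-3 frontier of S4 consists of exceptional classes as well (on the kernel; paper-level
dictionary NIGHT1.md §12).  Nothing geometric is built; nothing here says anything about the status of the
Hodge conjecture for CM abelian varieties, which is NOT proved.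
-/

set_option autoImplicit false

open Finset
open scoped Pointwise

namespace HodgeRepro.RouteC

open CMHodgeOn

section Level3

variable {G : Type*} [Group G] [DecidableEq G] [Fintype G]

omit [Fintype G] in
/-- In a place enumeration, `π m` lies in the place of `π i` only for `i = m`. -/
theorem notMem_place_of_isPlaceEnum {c : G} {π : Fin 4 → G} (hπ : IsPlaceEnum c π) {m i : Fin 4}
    (h : m ≠ i) : π m ∉ place c (π i) := by
  intro hmem
  obtain ⟨a, ha⟩ := Finset.card_eq_one.1 (hπ (π m))
  have hm : m ∈ univ.filter fun j => π m ∈ place c (π j) := by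
    rw [mem_filter]
    exact ⟨mem_univ m, mem_place_self c (π m)⟩
  have hi : i ∈ univ.filter fun j => π m ∈ place c (π j) := by
    rw [mem_filter]
    exact ⟨mem_univ i, hmem⟩
  rw [ha, mem_singleton] at hm hi
  exact h (hm.trans hi.symm)

-- The 36 corner pairs are dispatched by one of four witnesses `π m` with one simp set; the
-- unused-argument linter is silenced for this proof only.
set_option linter.unusedSimpArgs false in
/-- **No two corners of the level-3 family `B₃` are complementary** (`Φ` a CM type, `π` a place enumeration
— so `|G| = 8 > 4`). -/
theorem level3Family_ne_compl {c : G} (hc : IsComplexConj c) {Φ : Finset G} (hΦ : IsCMType c Φ)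
    {π : Fin 4 → G} (hπ : IsPlaceEnum c π) (i j : Fin 6) :
    level3Family c Φ π j ≠ (level3Family c Φ π i)ᶜ := by
  have h0 : ∀ m, π m ∈ place c (π m) := fun m => mem_place_self c (π m)
  have h01 : π 0 ∉ place c (π 1) := notMem_place_of_isPlaceEnum hπ (by decide)
  have h02 : π 0 ∉ place c (π 2) := notMem_place_of_isPlaceEnum hπ (by decide)
  have h03 : π 0 ∉ place c (π 3) := notMem_place_of_isPlaceEnum hπ (by decide)
  have h10 : π 1 ∉ place c (π 0) := notMem_place_of_isPlaceEnum hπ (by decide)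
  have h12 : π 1 ∉ place c (π 2) := notMem_place_of_isPlaceEnum hπ (by decide)
  have h13 : π 1 ∉ place c (π 3) := notMem_place_of_isPlaceEnum hπ (by decide)
  have h20 : π 2 ∉ place c (π 0) := notMem_place_of_isPlaceEnum hπ (by decide)
  have h21 : π 2 ∉ place c (π 1) := notMem_place_of_isPlaceEnum hπ (by decide)
  have h23 : π 2 ∉ place c (π 3) := notMem_place_of_isPlaceEnum hπ (by decide)
  have h30 : π 3 ∉ place c (π 0) := notMem_place_of_isPlaceEnum hπ (by decide)
  have h31 : π 3 ∉ place c (π 1) := notMem_place_of_isPlaceEnum hπ (by decide)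
  have h32 : π 3 ∉ place c (π 2) := notMem_place_of_isPlaceEnum hπ (by decide)
  intro h
  have hext := Finset.ext_iff.1 h
  fin_cases i <;> fin_cases j <;> simp only [level3Family, Matrix.cons_val] at hext
  all_goals first
    | simpa [mem_flipAt, hΦ.smul_eq_compl hc, h0, h01, h02, h03, h10, h12, h13, h20, h21, h23, h30, h31,
        h32] using hext (π 0)
    | simpa [mem_flipAt, hΦ.smul_eq_compl hc, h0, h01, h02, h03, h10, h12, h13, h20, h21, h23, h30, h31,
        h32] using hext (π 1)
    | simpa [mem_flipAt, hΦ.smul_eq_compl hc, h0, h01, h02, h03, h10, h12, h13, h20, h21, h23, h30, h31,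
        h32] using hext (π 2)
    | simpa [mem_flipAt, hΦ.smul_eq_compl hc, h0, h01, h02, h03, h10, h12, h13, h20, h21, h23, h30, h31,
        h32] using hext (π 3)

/-- **The Weil classes of the degree-8 level-3 family `B₃` are exceptional**: on the 24-fold
`Fin 6 × G` the Weil space meets the products of three divisor classes only in `0`. -/
theorem level3Family_weilSpaceProd_inf_divisorPowerIn_eq_bot {c : G} (hc : IsComplexConj c)
    {Φ : Finset G} (hΦ : IsCMType c Φ) {π : Fin 4 → G} (hπ : IsPlaceEnum c π) :
    weilSpaceProd G 3 (Equiv.refl (Fin (2 * 3))) ⊓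
      divisorPowerIn (fun g : G => prodTypeSet fun i => g • level3Family c Φ π i) 3 = ⊥ :=
  weilSpaceProd_inf_divisorPowerIn_eq_bot (by norm_num) _ _ (level3Family_ne_compl hc hΦ hπ)

end Level3

/-! ### typer g5's decic witness -/

/-- No two corners of the decic level-3 witness are complementary (the sealed-style table, by `decide`). -/
theorem level3Witness_ne_compl (i j : Fin 6) : level3Witness j ≠ (level3Witness i)ᶜ := by
  revert i j
  decide

/-- **The Weil classes of typer g5's decic level-3 witness are exceptional**: on the 30-fold
`Fin 6 × C₁₀` the Weil space meets the products of three divisor classes only in `0`. -/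
theorem level3Witness_weilSpaceProd_inf_divisorPowerIn_eq_bot :
    weilSpaceProd C10 3 (Equiv.refl (Fin (2 * 3))) ⊓
      divisorPowerIn (fun g : C10 => prodTypeSet fun i => g • level3Witness i) 3 = ⊥ :=
  weilSpaceProd_inf_divisorPowerIn_eq_bot (by norm_num) _ _ level3Witness_ne_compl

end HodgeRepro.RouteC
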